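import Summits.PneNP.PneNP.Theorems.SymmetryBudgetNoHiddenOrderCertifiedDecoding
import Summits.PneNP.PneNP.Theorems.SymmetryBudgetNoHiddenOrderPerPathCGProcess

/-!
# `NoHiddenOrder` (stmt-PneNP-14781), (R2c) value layer II: the replay decoding as a WALK — definitions

Route `PneNP/SymmetryBudget`.  The decoding map of the certified-label scheme is `CertifiedLabels.replay (cgProcess G) L I₀ ∅`
(`…CertifiedDecoding.lean`), a well-founded recursion.  A circuit of fixed depth realises it as an ITERATION of one step on
states `(block, colouring, consumed set, dead flag)`; this file defines that walk for the components-only Corneil–Goldberg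
process, in the vocabulary the gates compute:

* `WState`; the step conditions `Stop` (block `= U`, consumed `= X`), `IsAND` (the switching graph is disconnected inside
  the block), `IsOR` (connected, `≥ 2` vertices, first smallest cell of `≥ 2` vertices), `cands`/`Dom` (the not yet
  consumed label points of the cell; the unique `λ`-maximal one), `AndOK`/`andBlock` (all of `U` in one switching component;
  that component);
* `wstep` (one step: frozen if dead or stopped; AND: pass to the component of `U` or die; OR: individualise the dominating
  point, refine inside the block, consume it, or die; LEAF: die), `walk` (iterate), `init`, `result`.
`…DecodeWalk.lean` proves `replay = result ∘ walk` after `2·|V|` steps, the invariants of the walk (non-empty block, colours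
`< n`, equitable) and the automatic certification of part labels.  Definitions only; supports stmt-PneNP-14781.
-/

set_option linter.dupNamespace false -- `Summit.PneNP.PneNP.…` (D-0017 single-conjunct layout)

namespace Summit.PneNP.PneNP.Theorems

open Finset BranchSum

namespace CGBits

/-- A state of the replay walk: block, colouring, consumed label points, dead flag. [folklore] -/
structure WState (V : Type*) where
  /-- the block -/
  A : Finset V
  /-- the colouring -/
  col : V → ℕ
  /-- the consumed label points -/
  C : Finset V
  /-- the walk has failed -/
  dead : Bool

variable {V : Type*} [DecidableEq V] (G : SimpleGraph V) [DecidableRel G.Adj] (L : CertifiedLabels.Label V)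

namespace WState

/-- The walk of label `L` STOPS at a state whose block is `U` and whose consumed set is `X`. [folklore] -/
def Stop (S : WState V) : Prop := S.A = L.U ∧ S.C = L.X

/-- SECTION condition: the switching graph is disconnected inside the block. [folklore] -/
def IsAND (S : WState V) : Prop := ∃ u ∈ S.A, swReach G S.A S.col u ≠ S.A

/-- INDIVIDUALISATION condition: connected, `≥ 2` vertices, first smallest cell of `≥ 2` vertices. [folklore] -/
def IsOR (S : WState V) : Prop := ¬ IsAND G S ∧ 1 < S.A.card ∧ 2 ≤ (smallestCell S.A S.col).card

/-- The CANDIDATES of the OR-choice: points of the first smallest cell that are label points not yet consumed. [folklore] -/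
noncomputable def cands (S : WState V) : Finset V := (smallestCell S.A S.col).filter fun y => y ∈ L.X ∧ y ∉ S.C

/-- `y` DOMINATES: it is a candidate and every other candidate has a strictly smaller value. [folklore] -/
def Dom (S : WState V) (y : V) : Prop := y ∈ cands L S ∧ ∀ z ∈ cands L S, z ≠ y → L.lam z < L.lam y

/-- The AND-step is possible: `U` is non-empty and lies inside one switching component of the block. [folklore] -/
def AndOK (S : WState V) : Prop := L.U.Nonempty ∧ ∀ u ∈ L.U, ∀ u' ∈ L.U, u' ∈ swReach G S.A S.col u

/-- The component of the block met by `U` (the union of the components of the points of `U`). [folklore] -/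
noncomputable def andBlock (S : WState V) : Finset V := S.A.filter fun w => ∃ u ∈ L.U, w ∈ swReach G S.A S.col u

/-- `IsAND` is decidable. -/
instance (S : WState V) : Decidable (IsAND G S) := by unfold IsAND; infer_instance

/-- `Stop` is decidable. -/
instance (S : WState V) : Decidable (Stop L S) := by unfold Stop; infer_instance

end WState

open WState

open scoped Classical in
/-- **One step of the walk** of label `L`: frozen if dead or stopped; at a section node pass to the component of `U` (or die);
at an individualisation node individualise the dominating candidate, refine inside the block and consume it (or die); at a leaf
die. [folklore] -/
noncomputable def wstep (S : WState V) : WState V :=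
  if S.dead = true then S
  else if Stop L S then S
  else if IsAND G S then
    (if AndOK G L S then ⟨andBlock G L S, S.col, S.C, false⟩ else { S with dead := true })
  else if IsOR G S then
    (if h : ∃ y, Dom L S y then ⟨S.A, refineIn G S.A (indiv S.col h.choose), insert h.choose S.C, false⟩
      else { S with dead := true })
  else { S with dead := true }

/-- The walk: `k` steps. [folklore] -/
noncomputable def walk (S : WState V) (k : ℕ) : WState V := (wstep G L)^[k] S

/-- The start of the walk at an instance with consumed set `C`. [folklore] -/
def start (J : CGInst V) (C : Finset V) : WState V := ⟨J.1.1, J.1.2, C, false⟩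

open scoped Classical in
/-- The RESULT read off a state: the instance if alive and stopped. [folklore] -/
noncomputable def result (S : WState V) : Option (Finset V × (V → ℕ)) :=
  if S.dead = false ∧ Stop L S then some (S.A, S.col) else none

/-- The POTENTIAL bounding the number of productive steps: block size plus unconsumed room. [folklore] -/
def pot [Fintype V] (S : WState V) : ℕ := S.A.card + (Fintype.card V - S.C.card)

end CGBits

end Summit.PneNP.PneNP.Theorems
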